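import Mathlib
import Literature.Combinatorics.Optimization.LPRelaxationsMaxCSP
import Literature.Computability.Complexity.FourierDegreeAlgebra
import Literature.Computability.MetaComplexity.RandomCNFFirstMoment
import Literature.Computability.MetaComplexity.SumOfSquaresProofs

/-!
# Clause tuples as Max-3SAT / Max-3XOR instances, and the value of a random instance
# (Fleming–Kothari–Pitassi 2019, Lemma 5.3: Chernoff + union bound, as a COUNT)

Second support file (after `GrigorievSchoenebeckPseudoDensity.lean`) for the discharge of the
named facts `Schoenebeck2008_maxThreeSatSos` (`SDPRelaxationsMaxCSP.lean`) and
`Schoenebeck2008_maxThreeXorSA` (`MaxThreeXorLpLowerBound.lean`).  The probabilistic half of the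
Grigoriev–Schoenebeck theorem needs instances that are simultaneously EXPANDING (the tree's count
`card_le_of_forall_not_isCoverExpander_linear`, `RandomCNFFirstMoment.lean`, over clause tuples
`Fin m → kClauses 3 n`) and of SMALL VALUE.  This file supplies, over the same tuple space:

* the Max-3SAT instance `satInstance ω` (`CSPInstance 3 n maxThreeSatPreds`, one constraint per
  clause position, falsified exactly by the clause's falsifying pattern; `satConstraint_sat`:
  its satisfaction is the tree's `Clause.eval`) and the Max-3XOR instance `xorInstance ω`
  (`CSPInstance 3 n (literalClosure xorThree)`: on the scope of the `i`-th clause, the parity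
  constraint `χ_{scope}(x) = s` with `s = litSign` of the clause's first literal;
  `xorConstraint_sat_iff`), with their values as counts (`satInstance_val`, `xorInstance_val`);
* **FKP19 Lemma 5.3 as a count** (`card_filter_manyGood_le`, `card_filter_exists_manyGood_le`):
  in `Fin m → X`, if at most a `p`-fraction of `X` is "good" for each of the `2ⁿ` assignments, then
  the tuples for which SOME assignment makes more than `(p + ε) m` coordinates good number at most
  `2ⁿ · |X|^m · e^{−(1−p) ε² m}` — the exponential-moment method
  (`#{t ≤ N} ≤ e^{−λt} E e^{λN}`, `E e^{λN} = (|good| e^λ + |bad|)^m` by independence of the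
  coordinates, `1 + p(e^λ − 1) ≤ exp(p(e^λ − 1))`, `e^ε − 1 ≤ ε + ε²`, `λ = ε`), replacing the
  printed "standard Chernoff bound … `2^{O(−ε² m)}`";
* the two marginals: a fixed assignment satisfies at most `7/8` of the `3`-clauses
  (`card_filter_satGood_le`, from the tree's `card_filter_eval_le`) and makes the first-literal
  parity constraint true for exactly... at most `1/2` of them (`card_filter_xorGood_le`).

Everything is proved; no named facts.

## References

* N. Fleming, P. Kothari, T. Pitassi, *Semialgebraic Proofs and Efficient Algorithm Design*,
  Found. Trends TCS 14 (2019), §5.1, Def. 5.1 and Lemma 5.3 (p. 147–148 of the held text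
  `paper:galaxy-pdf-4841134338957687840`) [FlemingKothariPitassi2019].
* G. Schoenebeck, *Linear level Lasserre lower bounds for certain k-CSPs*, FOCS 2008, §5.
-/

noncomputable section

open Finset
open Literature.Probability.RandomGraphs.LowDegree (walsh sgn sgn_mul_self)
open Literature.Computability.Complexity (Literal Clause kClauses clauseOf)
open Literature.Computability.MetaComplexity (clauseScope mem_clauseScope card_clauseScope_of_nodup
  nodup_map_fst_of_mem_kClauses clauseScope_subset_range card_clauseScope_of_mem_kClauses
  exists_eq_clauseOf_of_mem_kClauses map_fst_clauseOf map_snd_clauseOf clauseScope_clauseOf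
  card_kClauses card_filter_eval_le litSign litSign_mul_self clauseOf_injOn)

namespace Literature.Combinatorics.Optimization

variable {n : ℕ}

/-! ### Clauses of `kClauses 3 n`: length, variables, positions -/

/-- A `k`-clause over `n` variables has exactly `k` literals.
[cite: FlemingKothariPitassi2019, §5.1 (Def. 5.1, p. 147)] -/
theorem length_of_mem_kClauses {k : ℕ} {C : Clause ℕ} (h : C ∈ kClauses k n) : C.length = k := by
  rw [← card_clauseScope_of_nodup (nodup_map_fst_of_mem_kClauses h), card_clauseScope_of_mem_kClauses h]

/-- The variables of a `k`-clause over `n` variables are `< n`.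
[cite: FlemingKothariPitassi2019, §5.1 (Def. 5.1, p. 147)] -/
theorem fst_lt_of_mem_kClauses {k : ℕ} {C : Clause ℕ} (h : C ∈ kClauses k n) :
    ∀ l ∈ C, l.1 < n := by
  intro l hl
  have h1 : l.1 ∈ clauseScope C := mem_clauseScope.2 ⟨l.2, by simpa using hl⟩
  exact Finset.mem_range.1 (clauseScope_subset_range h h1)

/-- The `j`-th literal (`j < 3`) of a `3`-clause. [cite: FlemingKothariPitassi2019, §5.1 (Def. 5.1)] -/
def lit3 (C : ↥(kClauses 3 n)) (j : Fin 3) : Literal ℕ :=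
  C.1[j.1]'(by rw [length_of_mem_kClauses C.2]; exact j.2)

/-- `lit3 C j` is a literal of `C`. [cite: FlemingKothariPitassi2019, §5.1 (Def. 5.1)] -/
theorem lit3_mem (C : ↥(kClauses 3 n)) (j : Fin 3) : lit3 C j ∈ C.1 :=
  List.getElem_mem _

/-- The variable of the `j`-th literal, as an element of `Fin n`.
[cite: FlemingKothariPitassi2019, §5.1 (Def. 5.1)] -/
def var3 (C : ↥(kClauses 3 n)) (j : Fin 3) : Fin n :=
  ⟨(lit3 C j).1, fst_lt_of_mem_kClauses C.2 _ (lit3_mem C j)⟩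

/-- The three variables are distinct: `var3 C` is injective.
[cite: FlemingKothariPitassi2019, §5.1 (Def. 5.1: "i, j, k … without replacement")] -/
theorem var3_injective (C : ↥(kClauses 3 n)) : Function.Injective (var3 C) := by
  intro j₁ j₂ h
  have hnd := nodup_map_fst_of_mem_kClauses C.2
  have hlen := length_of_mem_kClauses C.2
  have h' : (lit3 C j₁).1 = (lit3 C j₂).1 := by
    have := congrArg Fin.val h
    simpa [var3] using this
  have e1 : (C.1.map Prod.fst)[j₁.1]'(by simp [hlen]) = (lit3 C j₁).1 := List.getElem_map ..
  have e2 : (C.1.map Prod.fst)[j₂.1]'(by simp [hlen]) = (lit3 C j₂).1 := List.getElem_map ..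
  exact Fin.ext ((hnd.getElem_inj_iff).1 (e1.trans (h'.trans e2.symm)))

/-- The index embedding `Fin 3 ↪ Fin n` of a `3`-clause. [cite: FlemingKothariPitassi2019, §5.1 (Def. 5.1)] -/
def idx3 (C : ↥(kClauses 3 n)) : Fin 3 ↪ Fin n := ⟨var3 C, var3_injective C⟩

/-- The scope of a `3`-clause as a `3`-subset of `Fin n`. [cite: FlemingKothariPitassi2019, §5.1 (Def. 5.1)] -/
def scope3 (C : ↥(kClauses 3 n)) : Finset (Fin n) := univ.image (var3 C)

/-- `|scope3 C| = 3`. [cite: FlemingKothariPitassi2019, §5.1 (Def. 5.1)] -/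
theorem card_scope3 (C : ↥(kClauses 3 n)) : (scope3 C).card = 3 := by
  rw [scope3, card_image_of_injective _ (var3_injective C), card_univ, Fintype.card_fin]

/-- Every literal of a `3`-clause is one of `lit3 C 0, lit3 C 1, lit3 C 2`.
[cite: FlemingKothariPitassi2019, §5.1 (Def. 5.1)] -/
theorem exists_eq_lit3 (C : ↥(kClauses 3 n)) {l : Literal ℕ} (hl : l ∈ C.1) : ∃ j, lit3 C j = l := by
  obtain ⟨i, hi, rfl⟩ := List.mem_iff_getElem.1 hl
  have hlen := length_of_mem_kClauses C.2
  exact ⟨⟨i, by omega⟩, rfl⟩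

/-! ### The Max-3SAT instance of a clause tuple -/

/-- The falsifying pattern of a `3`-clause: the literal `(v, β)` is false iff `x_v = ¬β`.
[cite: FlemingKothariPitassi2019, §5.1 (p. 154: the 3SAT instance)] -/
def falsePattern (C : ↥(kClauses 3 n)) : Fin 3 → Bool := fun j => !(lit3 C j).2

/-- The Max-3SAT constraint of a `3`-clause (predicate `y ≠ falsePattern`, on the clause's three
variables). [cite: FlemingKothariPitassi2019, §5.1 (p. 154)] -/
def satConstraint (C : ↥(kClauses 3 n)) : CSPConstraint 3 n maxThreeSatPreds :=
  ⟨fun y => decide (y ≠ falsePattern C), ⟨falsePattern C, rfl⟩, idx3 C⟩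

/-- **The constraint is the clause:** for any assignment `σ` of all variables extending `x` on
`[n]`, `(satConstraint C).sat x = Clause.eval σ C`. [cite: FlemingKothariPitassi2019, §5.1 (p. 154)] -/
theorem satConstraint_sat (C : ↥(kClauses 3 n)) (x : Fin n → Bool) (σ : ℕ → Bool)
    (hσ : ∀ (v : ℕ) (h : v < n), σ v = x ⟨v, h⟩) :
    (satConstraint C).sat x = Literature.Computability.Complexity.Clause.eval σ C.1 := by
  have key : (satConstraint C).sat x = true ↔
      Literature.Computability.Complexity.Clause.eval σ C.1 = true := by
    rw [Literature.Computability.Complexity.Clause.eval, List.any_eq_true]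
    simp only [satConstraint, CSPConstraint.sat, decide_eq_true_eq]
    have hlit : ∀ j : Fin 3, Literature.Computability.Complexity.Literal.eval σ (lit3 C j) = true ↔
        x (var3 C j) = (lit3 C j).2 := by
      intro j
      rw [Literature.Computability.Complexity.Literal.eval, beq_iff_eq,
        hσ (lit3 C j).1 (var3 C j).2]
      rfl
    constructor
    · intro h
      obtain ⟨j, hj⟩ : ∃ j, x (idx3 C j) ≠ falsePattern C j := by
        by_contra hall
        push Not at hall
        exact h (funext hall)
      refine ⟨lit3 C j, lit3_mem C j, (hlit j).2 ?_⟩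
      have hj' : x (var3 C j) ≠ !(lit3 C j).2 := hj
      revert hj'
      cases x (var3 C j) <;> cases (lit3 C j).2 <;> simp
    · rintro ⟨l, hl, hlt⟩ heq
      obtain ⟨j, rfl⟩ := exists_eq_lit3 C hl
      have h1 : x (var3 C j) = !(lit3 C j).2 := congrFun heq j
      have h2 : x (var3 C j) = (lit3 C j).2 := (hlit j).1 hlt
      rw [h2] at h1
      revert h1
      cases (lit3 C j).2 <;> simp
  rcases Bool.eq_false_or_eq_true ((satConstraint C).sat x) with h | h <;>
    rcases Bool.eq_false_or_eq_true (Literature.Computability.Complexity.Clause.eval σ C.1)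
      with h' | h' <;> simp_all

variable {m : ℕ}

/-- **The Max-3SAT instance of a clause tuple** `ω : Fin m → kClauses 3 n` (`m ≥ 1`): one
constraint per clause position. [cite: FlemingKothariPitassi2019, §5.1 (Def. 5.1 and p. 154)] -/
def satInstance (ω : Fin m → ↥(kClauses 3 n)) (hm : 0 < m) : CSPInstance 3 n maxThreeSatPreds :=
  ⟨m, hm, fun i => satConstraint (ω i)⟩

/-- The value of the Max-3SAT instance at `x` is the fraction of clauses satisfied by any
extension `σ` of `x`. [cite: FlemingKothariPitassi2019, §5.1 (Lemma 5.3)] -/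
theorem satInstance_val (ω : Fin m → ↥(kClauses 3 n)) (hm : 0 < m) (x : Fin n → Bool)
    (σ : ℕ → Bool) (hσ : ∀ (v : ℕ) (h : v < n), σ v = x ⟨v, h⟩) :
    (satInstance ω hm).val x =
      ((univ.filter fun i : Fin m =>
        Literature.Computability.Complexity.Clause.eval σ (ω i).1 = true).card : ℝ) / m := by
  unfold CSPInstance.val satInstance
  simp only
  congr 1
  rw [← Finset.sum_boole]
  refine Finset.sum_congr rfl fun i _ => ?_
  rw [satConstraint_sat (ω i) x σ hσ]

/-! ### The Max-3XOR instance of a clause tuple -/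

/-- The parity shift of the XOR constraint of a clause: `(β₀, false, false)` with `β₀` the polarity
of the first literal, so that the constraint reads `χ_{scope}(x) = litSign (first literal)`.
[cite: FlemingKothariPitassi2019, §5.1 (p. 148: `x_i x_j x_k = b_{ijk}`, `b = ±1`)] -/
def xorPattern (C : ↥(kClauses 3 n)) : Fin 3 → Bool := fun j => if j = 0 then (lit3 C 0).2 else false

/-- The Max-3XOR constraint (CSP(`xor₃`) with literals) of a `3`-clause: the parity constraint
`χ_{scope}(x) = litSign (lit3 C 0)` on the clause's three variables.
[cite: FlemingKothariPitassi2019, §5.1 (Def. 5.1, p. 147–148)] -/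
def xorConstraint (C : ↥(kClauses 3 n)) : CSPConstraint 3 n (literalClosure xorThree) :=
  ⟨fun y => xorThree fun j => xor (y j) (xorPattern C j), ⟨xorPattern C, rfl⟩, idx3 C⟩

/-- The right-hand side `±1` of the XOR constraint of a clause. [cite: FlemingKothariPitassi2019, §5.1 (p. 148)] -/
def xorSign (C : ↥(kClauses 3 n)) : ℝ := litSign (lit3 C 0)

/-- `xorSign C = ±1`. [cite: FlemingKothariPitassi2019, §5.1 (p. 148)] -/
theorem xorSign_mul_self (C : ↥(kClauses 3 n)) : xorSign C * xorSign C = 1 := litSign_mul_self _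

/-- `χ_{scope3 C}(x) = ∏_{j<3} (−1)^{x_{v_j}}`. [cite: FlemingKothariPitassi2019, §5.1 (Def. 5.4)] -/
theorem walsh_scope3 (C : ↥(kClauses 3 n)) (x : Fin n → Bool) :
    walsh (scope3 C) x = ∏ j : Fin 3, sgn (x (var3 C j)) := by
  rw [walsh, scope3, Finset.prod_image fun j₁ _ j₂ _ h => var3_injective C h]

/-- **The XOR constraint in `±1` coordinates:** `(xorConstraint C).sat x ↔ χ_{scope3 C}(x) = xorSign C`.
[cite: FlemingKothariPitassi2019, §5.1 (p. 148: "apply the linear transformation `1 − 2x`")] -/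
theorem xorConstraint_sat_iff (C : ↥(kClauses 3 n)) (x : Fin n → Bool) :
    (xorConstraint C).sat x = true ↔ walsh (scope3 C) x = xorSign C := by
  have hsat : (xorConstraint C).sat x =
      xor (xor (xor (x (var3 C 0)) (lit3 C 0).2) (x (var3 C 1))) (x (var3 C 2)) := by
    simp [xorConstraint, CSPConstraint.sat, xorThree, xorPattern, idx3]
  rw [hsat, walsh_scope3, Fin.prod_univ_three, xorSign, litSign]
  cases x (var3 C 0) <;> cases x (var3 C 1) <;> cases x (var3 C 2) <;> cases (lit3 C 0).2 <;>
    simp [sgn] <;> norm_num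

/-- **The Max-3XOR instance of a clause tuple** `ω : Fin m → kClauses 3 n` (`m ≥ 1`).
[cite: FlemingKothariPitassi2019, §5.1 (Def. 5.1)] -/
def xorInstance (ω : Fin m → ↥(kClauses 3 n)) (hm : 0 < m) :
    CSPInstance 3 n (literalClosure xorThree) :=
  ⟨m, hm, fun i => xorConstraint (ω i)⟩

/-- The value of the Max-3XOR instance at `x` as a count.
[cite: FlemingKothariPitassi2019, §5.1 (Lemma 5.3)] -/
theorem xorInstance_val (ω : Fin m → ↥(kClauses 3 n)) (hm : 0 < m) (x : Fin n → Bool) :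
    (xorInstance ω hm).val x =
      ((univ.filter fun i : Fin m => walsh (scope3 (ω i)) x = xorSign (ω i)).card : ℝ) / m := by
  unfold CSPInstance.val xorInstance
  simp only
  congr 1
  rw [← Finset.sum_boole]
  refine Finset.sum_congr rfl fun i _ => ?_
  by_cases h : walsh (scope3 (ω i)) x = xorSign (ω i)
  · rw [if_pos ((xorConstraint_sat_iff (ω i) x).2 h), if_pos h]
  · have : ¬ (xorConstraint (ω i)).sat x = true := fun h' => h ((xorConstraint_sat_iff (ω i) x).1 h')
    rw [if_neg this, if_neg h]

/-! ### The exponential-moment count (FKP19 Lemma 5.3 as a count) -/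

section Count

variable {X : Type*} [Fintype X] [DecidableEq X]

omit [DecidableEq X] in
/-- **Independence of the coordinates:** `Σ_{ω : Fin m → X} ∏_i w(ω i) = (Σ_x w x)^m`.
[cite: FlemingKothariPitassi2019, §5.1 (proof of Lemma 5.3: "independent Bernoulli random variables")] -/
theorem sum_prod_coord_eq_pow (m : ℕ) (w : X → ℝ) :
    ∑ ω : Fin m → X, ∏ i, w (ω i) = (∑ x, w x) ^ m := by
  have h := Finset.prod_univ_sum (fun _ : Fin m => (univ : Finset X)) (fun _ x => w x)
  rw [Fintype.piFinset_univ] at h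
  rw [← h, Finset.prod_const, card_univ, Fintype.card_fin]

/-- **Exponential-moment bound:** for `λ ≥ 0` and any threshold `t`, the tuples with at least `t`
good coordinates number at most `e^{−λt} (|good| e^λ + |X ∖ good|)^m`.
[cite: FlemingKothariPitassi2019, §5.1 (Lemma 5.3: "a standard Chernoff bound")] -/
theorem card_filter_manyGood_le_expMoment (good : X → Prop) [DecidablePred good] (m : ℕ)
    (t lam : ℝ) (hlam : 0 ≤ lam) :
    (((univ : Finset (Fin m → X)).filter fun ω =>
        t ≤ ((univ.filter fun i => good (ω i)).card : ℝ)).card : ℝ) ≤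
      Real.exp (-(lam * t)) *
        ((univ.filter good).card * Real.exp lam + (Fintype.card X - (univ.filter good).card)) ^ m := by
  classical
  set w : X → ℝ := fun x => if good x then Real.exp lam else 1 with hw
  -- the weight of a tuple is `exp (λ · #good)`
  have hprod : ∀ ω : Fin m → X,
      ∏ i, w (ω i) = Real.exp (lam * ((univ.filter fun i => good (ω i)).card : ℝ)) := by
    intro ω
    have : ∀ i, w (ω i) = Real.exp (lam * if good (ω i) then 1 else 0) := by
      intro i; simp only [hw]; split_ifs <;> simp
    rw [Finset.prod_congr rfl fun i _ => this i, ← Real.exp_sum, ← Finset.mul_sum]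
    congr 2
    rw [Finset.sum_boole]
  -- sum of the weights
  have hsum : ∑ x, w x = (univ.filter good).card * Real.exp lam +
      (Fintype.card X - (univ.filter good).card) := by
    simp only [hw]
    rw [Finset.sum_ite, Finset.sum_const, Finset.sum_const, nsmul_eq_mul, nsmul_eq_mul, mul_one]
    congr 1
    rw [Finset.filter_not, Finset.card_sdiff_of_subset (Finset.filter_subset _ _), card_univ,
      Nat.cast_sub (Finset.card_le_univ _)]
  rw [← hsum, ← sum_prod_coord_eq_pow]
  -- indicator ≤ exp (λ (#good - t))
  rw [Finset.card_eq_sum_ones, Nat.cast_sum, Finset.mul_sum]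
  simp only [Nat.cast_one]
  calc ∑ ω ∈ univ.filter (fun ω : Fin m → X => t ≤ ((univ.filter fun i => good (ω i)).card : ℝ)),
        (1 : ℝ)
      ≤ ∑ ω ∈ univ.filter (fun ω : Fin m → X => t ≤ ((univ.filter fun i => good (ω i)).card : ℝ)),
          Real.exp (-(lam * t)) * ∏ i, w (ω i) := by
        refine Finset.sum_le_sum fun ω hω => ?_
        rw [hprod, ← Real.exp_add]
        have ht : t ≤ ((univ.filter fun i => good (ω i)).card : ℝ) := (Finset.mem_filter.1 hω).2
        have : 0 ≤ -(lam * t) + lam * ((univ.filter fun i => good (ω i)).card : ℝ) := by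
          nlinarith
        exact Real.one_le_exp this
    _ ≤ ∑ ω : Fin m → X, Real.exp (-(lam * t)) * ∏ i, w (ω i) := by
        refine Finset.sum_le_sum_of_subset_of_nonneg (Finset.filter_subset _ _) fun ω _ _ => ?_
        refine mul_nonneg (Real.exp_nonneg _) (Finset.prod_nonneg fun i _ => ?_)
        simp only [hw]; split_ifs
        · exact Real.exp_nonneg _
        · exact zero_le_one

/-- `A e^λ + (N − A) ≤ N exp(p (e^λ − 1))` for `0 ≤ A ≤ p N`, `λ ≥ 0` (the Bernoulli moment
generating function bound `1 + p(e^λ − 1) ≤ e^{p(e^λ − 1)}`).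
[cite: FlemingKothariPitassi2019, §5.1 (Lemma 5.3, Chernoff bound)] -/
theorem bernoulli_mgf_le {A N p lam : ℝ} (hAN : A ≤ p * N) (hN : 0 ≤ N) (hlam : 0 ≤ lam) :
    A * Real.exp lam + (N - A) ≤ N * Real.exp (p * (Real.exp lam - 1)) := by
  have h1 : 0 ≤ Real.exp lam - 1 := by
    have := Real.one_le_exp hlam; linarith
  have h2 : A * Real.exp lam + (N - A) = N + A * (Real.exp lam - 1) := by ring
  have h3 : A * (Real.exp lam - 1) ≤ p * N * (Real.exp lam - 1) :=
    mul_le_mul_of_nonneg_right hAN h1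
  have h4 : 1 + p * (Real.exp lam - 1) ≤ Real.exp (p * (Real.exp lam - 1)) := by
    have := Real.add_one_le_exp (p * (Real.exp lam - 1)); linarith
  calc A * Real.exp lam + (N - A) = N + A * (Real.exp lam - 1) := h2
    _ ≤ N + p * N * (Real.exp lam - 1) := by linarith
    _ = N * (1 + p * (Real.exp lam - 1)) := by ring
    _ ≤ N * Real.exp (p * (Real.exp lam - 1)) := mul_le_mul_of_nonneg_left h4 hN

/-- The exponent at `λ = ε ∈ [0,1]`, threshold `t = (p + ε) m`:
`m p (e^ε − 1) − ε (p + ε) m ≤ −(1 − p) ε² m` (from `e^ε − 1 ≤ ε + ε²`).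
[cite: FlemingKothariPitassi2019, §5.1 (Lemma 5.3: `2^{O(−ε² m)}`)] -/
theorem chernoff_exponent_le {p ε M : ℝ} (hp0 : 0 ≤ p) (hε0 : 0 ≤ ε) (hε1 : ε ≤ 1) (hM : 0 ≤ M) :
    M * (p * (Real.exp ε - 1)) - ε * ((p + ε) * M) ≤ -((1 - p) * ε ^ 2 * M) := by
  have h1 : Real.exp ε - 1 ≤ ε + ε ^ 2 := by
    have h := Real.abs_exp_sub_one_sub_id_le (x := ε) (by rw [abs_of_nonneg hε0]; exact hε1)
    have := (abs_le.1 h).2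
    linarith
  have h2 : M * (p * (Real.exp ε - 1)) ≤ M * (p * (ε + ε ^ 2)) :=
    mul_le_mul_of_nonneg_left (mul_le_mul_of_nonneg_left h1 hp0) hM
  nlinarith

/-- **FKP19 Lemma 5.3 for ONE assignment, as a count.** If at most `p |X|` elements of `X` are good,
then the tuples `ω : Fin m → X` with more than `(p + ε) m` good coordinates number at most
`|X|^m · e^{−(1−p) ε² m}` (`0 ≤ p`, `0 ≤ ε ≤ 1`).
[cite: FlemingKothariPitassi2019, §5.1 (Lemma 5.3)] -/
theorem card_filter_manyGood_le (good : X → Prop) [DecidablePred good] {p ε : ℝ} (hp0 : 0 ≤ p)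
    (hgood : ((univ.filter good).card : ℝ) ≤ p * Fintype.card X) (hε0 : 0 ≤ ε) (hε1 : ε ≤ 1)
    (m : ℕ) :
    (((univ : Finset (Fin m → X)).filter fun ω =>
        (p + ε) * m < ((univ.filter fun i => good (ω i)).card : ℝ)).card : ℝ) ≤
      (Fintype.card X : ℝ) ^ m * Real.exp (-((1 - p) * ε ^ 2 * m)) := by
  classical
  have hN : (0 : ℝ) ≤ Fintype.card X := Nat.cast_nonneg _
  have h1 := card_filter_manyGood_le_expMoment good m ((p + ε) * m) ε hε0
  have hsub : ((univ : Finset (Fin m → X)).filter fun ω =>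
        (p + ε) * m < ((univ.filter fun i => good (ω i)).card : ℝ)) ⊆
      (univ : Finset (Fin m → X)).filter fun ω =>
        (p + ε) * m ≤ ((univ.filter fun i => good (ω i)).card : ℝ) := by
    intro ω hω
    simp only [Finset.mem_filter, Finset.mem_univ, true_and] at hω ⊢
    exact hω.le
  have h2 := bernoulli_mgf_le (lam := ε) hgood hN hε0
  have h3 : (0 : ℝ) ≤ (univ.filter good).card * Real.exp ε +
      (Fintype.card X - (univ.filter good).card) := by
    have : ((univ.filter good).card : ℝ) ≤ Fintype.card X := by
      exact_mod_cast Finset.card_le_univ _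
    have hc0 : (0 : ℝ) ≤ ((univ.filter good).card : ℝ) := Nat.cast_nonneg _
    nlinarith [Real.exp_nonneg ε, hc0]
  calc (((univ : Finset (Fin m → X)).filter fun ω =>
          (p + ε) * m < ((univ.filter fun i => good (ω i)).card : ℝ)).card : ℝ)
      ≤ (((univ : Finset (Fin m → X)).filter fun ω =>
          (p + ε) * m ≤ ((univ.filter fun i => good (ω i)).card : ℝ)).card : ℝ) := by
        exact_mod_cast Finset.card_le_card hsub
    _ ≤ Real.exp (-(ε * ((p + ε) * m))) *
          ((univ.filter good).card * Real.exp ε + (Fintype.card X - (univ.filter good).card)) ^ m := h1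
    _ ≤ Real.exp (-(ε * ((p + ε) * m))) *
          ((Fintype.card X : ℝ) * Real.exp (p * (Real.exp ε - 1))) ^ m := by
        gcongr
    _ = (Fintype.card X : ℝ) ^ m *
          Real.exp (m * (p * (Real.exp ε - 1)) - ε * ((p + ε) * m)) := by
        rw [mul_pow, ← Real.exp_nat_mul, Real.exp_sub, Real.exp_neg]
        field_simp
    _ ≤ (Fintype.card X : ℝ) ^ m * Real.exp (-((1 - p) * ε ^ 2 * m)) := by
        gcongr
        exact chernoff_exponent_le hp0 hε0 hε1 (Nat.cast_nonneg m)

/-- **FKP19 Lemma 5.3 as a count (union over the `2ⁿ` assignments).** If for every assignment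
`σ ∈ {0,1}ⁿ` at most `p |X|` elements are good, then the tuples for which SOME assignment has
more than `(p + ε) m` good coordinates number at most `2ⁿ · |X|^m · e^{−(1−p) ε² m}`.
[cite: FlemingKothariPitassi2019, §5.1 (Lemma 5.3: "by a union bound on all x")] -/
theorem card_filter_exists_manyGood_le (good : (Fin n → Bool) → X → Prop)
    [∀ σ, DecidablePred (good σ)] {p ε : ℝ} (hp0 : 0 ≤ p)
    (hgood : ∀ σ, ((univ.filter (good σ)).card : ℝ) ≤ p * Fintype.card X) (hε0 : 0 ≤ ε)
    (hε1 : ε ≤ 1) (m : ℕ) :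
    (((univ : Finset (Fin m → X)).filter fun ω => ∃ σ : Fin n → Bool,
        (p + ε) * m < ((univ.filter fun i => good σ (ω i)).card : ℝ)).card : ℝ) ≤
      2 ^ n * ((Fintype.card X : ℝ) ^ m * Real.exp (-((1 - p) * ε ^ 2 * m))) := by
  classical
  have hunion : ((univ : Finset (Fin m → X)).filter fun ω => ∃ σ : Fin n → Bool,
        (p + ε) * m < ((univ.filter fun i => good σ (ω i)).card : ℝ)) =
      (univ : Finset (Fin n → Bool)).biUnion fun σ => (univ : Finset (Fin m → X)).filter fun ω =>
        (p + ε) * m < ((univ.filter fun i => good σ (ω i)).card : ℝ) := by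
    ext ω; simp
  rw [hunion]
  calc (((univ : Finset (Fin n → Bool)).biUnion fun σ => (univ : Finset (Fin m → X)).filter fun ω =>
          (p + ε) * m < ((univ.filter fun i => good σ (ω i)).card : ℝ)).card : ℝ)
      ≤ ∑ σ : Fin n → Bool, ((((univ : Finset (Fin m → X)).filter fun ω =>
          (p + ε) * m < ((univ.filter fun i => good σ (ω i)).card : ℝ)).card : ℝ)) := by
        exact_mod_cast Finset.card_biUnion_le
    _ ≤ ∑ _σ : Fin n → Bool, (Fintype.card X : ℝ) ^ m * Real.exp (-((1 - p) * ε ^ 2 * m)) :=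
        Finset.sum_le_sum fun σ _ => card_filter_manyGood_le (good σ) hp0 (hgood σ) hε0 hε1 m
    _ = 2 ^ n * ((Fintype.card X : ℝ) ^ m * Real.exp (-((1 - p) * ε ^ 2 * m))) := by
        rw [Finset.sum_const, card_univ, Fintype.card_fun, Fintype.card_bool, Fintype.card_fin,
          nsmul_eq_mul]
        push_cast
        ring

end Count

/-! ### The two marginals: a fixed assignment vs a uniform `3`-clause -/

/-- A subtype filter is bounded by the corresponding filter of the underlying finset. [folklore] -/
private theorem card_filter_univ_subtype_le {α : Type*} [DecidableEq α] (s : Finset α)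
    (P : α → Prop) [DecidablePred P] :
    ((univ : Finset ↥s).filter fun x => P x.1).card ≤ (s.filter P).card := by
  refine Finset.card_le_card_of_injOn (fun x => x.1) (fun x hx => ?_) (fun x _ y _ h => Subtype.ext h)
  simp only [Finset.coe_filter, Finset.mem_univ, true_and, Set.mem_setOf_eq] at hx ⊢
  exact ⟨x.2, hx⟩

/-- **At most `7/8` of the `3`-clauses are true under a fixed assignment** (for each scope exactly
one of the `8` sign patterns is falsified; the tree's `card_filter_eval_le`).
[cite: FlemingKothariPitassi2019, §5.1 (Lemma 5.3 analogue for 3SAT, p. 154)] -/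
theorem card_filter_satGood_le (σ : ℕ → Bool) :
    (((univ : Finset ↥(kClauses 3 n)).filter fun C =>
        Literature.Computability.Complexity.Clause.eval σ C.1 = true).card : ℝ) ≤
      (7 / 8 : ℝ) * Fintype.card ↥(kClauses 3 n) := by
  have h1 := card_filter_univ_subtype_le (kClauses 3 n)
    (fun C => Literature.Computability.Complexity.Clause.eval σ C = true)
  have h2 := card_filter_eval_le 3 n σ
  norm_num at h2
  have h3 : Fintype.card ↥(kClauses 3 n) = n.choose 3 * 8 := by
    rw [Fintype.card_coe, card_kClauses]; norm_num
  rw [h3]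
  have h4 : (((univ : Finset ↥(kClauses 3 n)).filter fun C =>
      Literature.Computability.Complexity.Clause.eval σ C.1 = true).card : ℝ) ≤ n.choose 3 * 7 := by
    exact_mod_cast h1.trans h2
  push_cast
  linarith

/-- Extension of a sign pattern on `Fin 3` to all naturals (by `false`), as in the definition of
`kClauses`. [cite: FlemingKothariPitassi2019, §5.1 (Def. 5.1)] -/
def ext3 (e : Fin 3 → Bool) : ℕ → Bool := fun i => if h : i < 3 then e ⟨i, h⟩ else false

/-- The parametrisation of `kClauses 3 n` by (scope, sign pattern).
[cite: FlemingKothariPitassi2019, §5.1 (Def. 5.1)] -/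
theorem kClauses_three_eq_image :
    kClauses 3 n = (((univ : Finset (Fin n)).powersetCard 3) ×ˢ (univ : Finset (Fin 3 → Bool))).image
      fun q => clauseOf q.1 (ext3 q.2) := rfl

/-- `clauseOf S (ext3 e)` is a `3`-clause for `|S| = 3`. [cite: FlemingKothariPitassi2019, §5.1 (Def. 5.1)] -/
theorem clauseOf_ext3_mem {S : Finset (Fin n)} (hS : S.card = 3) (e : Fin 3 → Bool) :
    clauseOf S (ext3 e) ∈ kClauses 3 n := by
  rw [kClauses_three_eq_image, Finset.mem_image]
  exact ⟨(S, e), Finset.mem_product.2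
    ⟨Finset.mem_powersetCard.2 ⟨Finset.subset_univ _, hS⟩, Finset.mem_univ _⟩, rfl⟩

/-- The first literal of `clauseOf S ε` has polarity `ε 0`.
[cite: FlemingKothariPitassi2019, §5.1 (Def. 5.1)] -/
theorem lit3_zero_snd {S : Finset (Fin n)} (ε : ℕ → Bool) (h : clauseOf S ε ∈ kClauses 3 n) :
    (lit3 ⟨clauseOf S ε, h⟩ 0).2 = ε 0 := by
  have hlen : (clauseOf S ε).length = 3 := length_of_mem_kClauses h
  have e : ((clauseOf S ε).map Prod.snd)[0]'(by simp [hlen]) = (lit3 ⟨clauseOf S ε, h⟩ 0).2 :=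
    List.getElem_map ..
  rw [← e]
  simp only [map_snd_clauseOf, List.getElem_map, List.getElem_range]

/-- Hence the XOR sign of `clauseOf S (ext3 e)` is `+1` if `e 0` and `−1` otherwise.
[cite: FlemingKothariPitassi2019, §5.1 (p. 148)] -/
theorem xorSign_clauseOf_ext3 {S : Finset (Fin n)} (e : Fin 3 → Bool)
    (h : clauseOf S (ext3 e) ∈ kClauses 3 n) :
    xorSign ⟨clauseOf S (ext3 e), h⟩ = if e 0 then 1 else -1 := by
  rw [xorSign, litSign, lit3_zero_snd _ h]
  simp [ext3]

/-- The scope of `clauseOf S ε` (as a subset of `Fin n`) is `S`. [cite: FlemingKothariPitassi2019, §5.1 (Def. 5.1)] -/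
theorem scope3_clauseOf {S : Finset (Fin n)} (ε : ℕ → Bool) (h : clauseOf S ε ∈ kClauses 3 n) :
    scope3 ⟨clauseOf S ε, h⟩ = S := by
  have hmap : (scope3 ⟨clauseOf S ε, h⟩).map Fin.valEmbedding = S.map Fin.valEmbedding := by
    rw [← clauseScope_clauseOf S ε]
    ext v
    simp only [Finset.mem_map, Fin.valEmbedding_apply, scope3, Finset.mem_image, Finset.mem_univ,
      true_and, mem_clauseScope]
    constructor
    · rintro ⟨i, ⟨j, rfl⟩, rfl⟩
      exact ⟨(lit3 ⟨clauseOf S ε, h⟩ j).2, by simpa [var3] using lit3_mem ⟨clauseOf S ε, h⟩ j⟩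
    · rintro ⟨b, hb⟩
      obtain ⟨j, hj⟩ := exists_eq_lit3 ⟨clauseOf S ε, h⟩ hb
      exact ⟨var3 ⟨clauseOf S ε, h⟩ j, ⟨j, rfl⟩, by simp [var3, hj]⟩
  exact Finset.map_injective _ hmap

/-- Of the `8` sign patterns on `Fin 3`, exactly `4` have a prescribed first coordinate. [folklore] -/
private theorem card_filter_apply_zero_eq (c : Bool) :
    ((univ : Finset (Fin 3 → Bool)).filter fun e => e 0 = c).card = 4 := by
  revert c; decide

/-- On a fixed scope `S`, exactly... at most `4` of the `8` sign patterns make the first-literal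
parity constraint true at `x`. [cite: FlemingKothariPitassi2019, §5.1 (Lemma 5.3: Bernoulli with expectation `1/2`)] -/
theorem card_filter_xorGood_scope_le {S : Finset (Fin n)} (hS : S.card = 3) (x : Fin n → Bool) :
    ((univ : Finset (Fin 3 → Bool)).filter fun e => ∃ h : clauseOf S (ext3 e) ∈ kClauses 3 n,
      walsh (scope3 ⟨clauseOf S (ext3 e), h⟩) x = xorSign ⟨clauseOf S (ext3 e), h⟩).card ≤ 4 := by
  have hw : walsh S x = 1 ∨ walsh S x = -1 := by
    refine mul_self_eq_one_iff.1 ?_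
    rw [Literature.Computability.Complexity.LowDegree.walsh_mul_walsh, symmDiff_self,
      Finset.bot_eq_empty, Literature.Probability.RandomGraphs.LowDegree.walsh_empty]
  have hiff : ∀ e : Fin 3 → Bool, (∃ h : clauseOf S (ext3 e) ∈ kClauses 3 n,
      walsh (scope3 ⟨clauseOf S (ext3 e), h⟩) x = xorSign ⟨clauseOf S (ext3 e), h⟩) ↔
      e 0 = decide (walsh S x = 1) := by
    intro e
    have hmem := clauseOf_ext3_mem hS e
    rw [exists_prop_of_true hmem, scope3_clauseOf _ hmem, xorSign_clauseOf_ext3 e hmem]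
    rcases hw with hw | hw <;> cases e 0 <;> simp [hw] <;> norm_num
  rw [Finset.filter_congr fun e _ => hiff e, card_filter_apply_zero_eq]

/-- **At most half of the `3`-clauses make the first-literal parity constraint true under a fixed
assignment** (for each scope, `4` of the `8` sign patterns).
[cite: FlemingKothariPitassi2019, §5.1 (Lemma 5.3: "each `Y_j^α` is an independent Bernoulli random variable with expectation `1/2`")] -/
theorem card_filter_xorGood_le (x : Fin n → Bool) :
    (((univ : Finset ↥(kClauses 3 n)).filter fun C => walsh (scope3 C) x = xorSign C).card : ℝ) ≤
      (1 / 2 : ℝ) * Fintype.card ↥(kClauses 3 n) := by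
  classical
  set dom := ((univ : Finset (Fin n)).powersetCard 3) ×ˢ (univ : Finset (Fin 3 → Bool)) with hdom
  set P : Clause ℕ → Prop := fun C => ∃ h : C ∈ kClauses 3 n,
    walsh (scope3 ⟨C, h⟩) x = xorSign ⟨C, h⟩ with hP
  have hinj : Set.InjOn (fun q : Finset (Fin n) × (Fin 3 → Bool) => clauseOf q.1 (ext3 q.2)) ↑dom :=
    clauseOf_injOn 3 n
  have h1 : ((univ : Finset ↥(kClauses 3 n)).filter fun C => walsh (scope3 C) x = xorSign C).card ≤
      ((kClauses 3 n).filter P).card := by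
    refine Finset.card_le_card_of_injOn (fun C => C.1) (fun C hC => ?_)
      (fun a _ b _ h => Subtype.ext h)
    simp only [Finset.coe_filter, Finset.mem_univ, true_and, Set.mem_setOf_eq] at hC ⊢
    exact ⟨C.2, C.2, hC⟩
  have h2 : ((kClauses 3 n).filter P).card =
      (dom.filter fun q => P (clauseOf q.1 (ext3 q.2))).card := by
    have himg : (dom.filter fun q => P (clauseOf q.1 (ext3 q.2))).image
        (fun q : Finset (Fin n) × (Fin 3 → Bool) => clauseOf q.1 (ext3 q.2)) =
        (kClauses 3 n).filter P := by
      ext C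
      have hK : C ∈ kClauses 3 n ↔ ∃ q ∈ dom, clauseOf q.1 (ext3 q.2) = C := by
        rw [kClauses_three_eq_image, Finset.mem_image]
      simp only [Finset.mem_image, Finset.mem_filter, hK]
      constructor
      · rintro ⟨q, ⟨hq, hPq⟩, rfl⟩
        exact ⟨⟨q, hq, rfl⟩, hPq⟩
      · rintro ⟨⟨q, hq, rfl⟩, hPq⟩
        exact ⟨q, ⟨hq, hPq⟩, rfl⟩
    rw [← himg, Finset.card_image_of_injOn (hinj.mono (Finset.coe_subset.2 (Finset.filter_subset _ _)))]
  have h4 : (dom.filter fun q => P (clauseOf q.1 (ext3 q.2))).card ≤ n.choose 3 * 4 := by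
    rw [Finset.card_filter, hdom, Finset.sum_product]
    calc ∑ S ∈ (univ : Finset (Fin n)).powersetCard 3, ∑ e ∈ (univ : Finset (Fin 3 → Bool)),
          (if P (clauseOf (S, e).1 (ext3 (S, e).2)) then 1 else 0)
        = ∑ S ∈ (univ : Finset (Fin n)).powersetCard 3,
            ((univ : Finset (Fin 3 → Bool)).filter fun e => P (clauseOf S (ext3 e))).card := by
          refine Finset.sum_congr rfl fun S _ => ?_
          rw [Finset.card_filter]
      _ ≤ ∑ _S ∈ (univ : Finset (Fin n)).powersetCard 3, 4 := by
          refine Finset.sum_le_sum fun S hS => ?_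
          exact card_filter_xorGood_scope_le (Finset.mem_powersetCard.1 hS).2 x
      _ = n.choose 3 * 4 := by
          rw [Finset.sum_const, Finset.card_powersetCard, card_univ, Fintype.card_fin, smul_eq_mul]
  have h5 : Fintype.card ↥(kClauses 3 n) = n.choose 3 * 8 := by
    rw [Fintype.card_coe, card_kClauses]; norm_num
  rw [h5]
  have h6 : (((univ : Finset ↥(kClauses 3 n)).filter fun C =>
      walsh (scope3 C) x = xorSign C).card : ℝ) ≤ n.choose 3 * 4 := by
    exact_mod_cast h1.trans (h2 ▸ h4)
  push_cast
  linarith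

end Literature.Combinatorics.Optimization
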